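import Summits.AtomisticToContinuum.HydrodynamicLimit.Theorems.ImplosionDichotomyDenseExcursionR2AdmissibleData

/-!
# `DenseExcursion` is a flow-free equation-of-state PDE statement (line `r2-one-mode-two-conditions`, helper)

Helper `denseExcursion_iff_eosData` of the registered skeleton `Cruxes/DenseExcursion/Lines/r2-one-mode-two-conditions.lean`
(crux `ImplosionDichotomy.DenseExcursion`, item stmt-AtomisticToContinuum-12586).

The crux quantifies over particle flows, local Gibbs laws and limits in probability only through its admissibility
clause `∀ Φ, TendstoHydroFieldsAt … 0`. By the landed data pinning `PolynomialCompressionPDE.admissible_iff_data` that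
clause says `ρ 0 = rhoLim (profileOf a₀) σ ∧ u 0 = u₀ ∧ θ 0 = θ₀`, and by the landed statics of this line
(`ImplosionDichotomyDenseExcursionR2AdmissibleData`: `eosIdentityForRhoLim`, `rhoLim_le_two_mul_β`,
`integral_rhoLim_eq_one`) the cluster-series density `rhoLim` is `EosRelated` — the continuous positive unit-mass
solution of the BULK equation-of-state relation `log n + βμ_ex(n σ³) = log a₀ + const` on the dilute branch
`n ≤ 2a₀/∫a₀`. Here we prove that this intrinsic characterisation PINS the density:

* §1 `excessChemicalPotential_sub_le`, `eosMap_lt`: on `(0, η₂)` the excess chemical potential is `log Rf` with the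
  insertion factor `1 ≤ Rf ≤ 2` Lipschitz (`stub_eosRatioAnalytic`, identified with the `Rf` of
  `excessChemicalPotential_eq_log` through the unique-root clause), so `βμ_ex` is one-sidedly Lipschitz there and
  `g_σ(η) = log η + βμ_ex(η σ³)` is STRICTLY INCREASING as long as `η σ³ < η₀` (`log η' - log η ≥ (η' - η)/η'` beats
  `L σ³ (η' - η)` once `L σ³ η' < 1`);
* §2 `eosRelated_unique` (L1): two EOS-related densities at the same small `σ` coincide — order the constants
  `c ≤ c'`, read `g_σ(n x) ≤ g_σ(n' x)` backwards to `n ≤ n'`, and equal unit masses of continuous functions on `𝕋³`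
  force `c = c'`, whence `n = n'` by injectivity;
* §3 `eosRelated_rhoLim` (L2): `rhoLim (profileOf a₀) σ` is EOS-related for small `σ`;
* §4 `denseExcursion_iff_eosData`: the crux is equivalent to the particle-free statement "for some `η > 0` and
  continuous positive profiles, along a sequence `σ → 0` the classical hard-sphere-Euler solution launched from THE
  EOS-related density of `a₀` with `(u₀, θ₀)` reaches packing fraction `η`" (`T > 0` from `∃ t ∈ Ico 0 T` gives
  continuous time-`0` slices, `PolynomialCompressionPDE.continuous_slices_zero`).

Sources: Ruelle 1969 §3.4, Lebowitz–Penrose 1964 (low-density equation of state), Spohn 1991 Part I §2.3 (local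
equilibrium), and the landed files cited above. Nothing here is conditional.
-/

noncomputable section

namespace Summit.AtomisticToContinuum.HydrodynamicLimit.Theorems.R2OneModeTwoConditions

open MeasureTheory Filter Set Topology
open Literature.MathematicalPhysics.KineticTheory Literature.Analysis.FluidPDE
open Summit.AtomisticToContinuum.HydrodynamicLimit.Theses.ImplosionDichotomy
open PolynomialCompressionPDE PolynomialCompressionStatics

/-! ### §1 The EOS map `η ↦ log η + βμ_ex(η σ³)` is strictly increasing on the dilute branch -/

/-- **One-sided Lipschitz bound for the excess chemical potential at low density.** There are `η₂ > 0` and `L ≥ 0`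
with `βμ_ex(a) - βμ_ex(b) ≤ L |a - b|` for `a, b ∈ (0, η₂)`: there `βμ_ex = log Rf` (`excessChemicalPotential_eq_log`)
for the analytic insertion factor `Rf` of `stub_eosRatioAnalytic` (the two `Rf`'s agree by uniqueness of the root of
`R Φ(xR) = 1` in `[1/2, 2]`), `1 ≤ Rf ≤ 2` and `Rf` is `L`-Lipschitz, and `log u - log v ≤ (u - v)/v ≤ |u - v|` for
`u, v ≥ 1`. -/
theorem excessChemicalPotential_sub_le :
    ∃ η₂ : ℝ, 0 < η₂ ∧ ∃ L : ℝ, 0 ≤ L ∧ ∀ a ∈ Ioo 0 η₂, ∀ b ∈ Ioo 0 η₂,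
      excessChemicalPotential a - excessChemicalPotential b ≤ L * |a - b| := by
  obtain ⟨η₁, hη₁, Rf₁, hμ, huniq₁⟩ := excessChemicalPotential_eq_log
  obtain ⟨r, hr, Rf, -, -, -, hsol, hbd, ⟨L, hLip⟩, -⟩ := stub_eosRatioAnalytic
  refine ⟨min η₁ r, lt_min hη₁ hr, L, L.coe_nonneg, fun a ha b hb => ?_⟩
  -- identify the two insertion factors on `(0, min η₁ r)`
  have hid : ∀ x ∈ Ioo 0 (min η₁ r), excessChemicalPotential x = Real.log (Rf x) ∧ 1 ≤ Rf x := by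
    intro x hx
    have hx₁ : x ∈ Ioo 0 η₁ := ⟨hx.1, lt_of_lt_of_le hx.2 (min_le_left _ _)⟩
    have hxr : x < r := lt_of_lt_of_le hx.2 (min_le_right _ _)
    have hb := hbd x ⟨hx.1.le, hxr.le⟩
    have hfix := (hsol x ⟨by linarith [hx.1], hxr⟩).2
    have hR : Rf x = Rf₁ x := huniq₁ x hx₁ (Rf x) ⟨by linarith [hb.1], hb.2⟩ hfix
    exact ⟨by rw [hμ x hx₁, ← hR], hb.1⟩
  obtain ⟨ha', ha1⟩ := hid a ha
  obtain ⟨hb', hb1⟩ := hid b hb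
  have hRa0 : 0 < Rf a := by linarith
  have hRb0 : 0 < Rf b := by linarith
  have hL := hLip.dist_le_mul a ⟨ha.1.le, (lt_of_lt_of_le ha.2 (min_le_right _ _)).le⟩ b
    ⟨hb.1.le, (lt_of_lt_of_le hb.2 (min_le_right _ _)).le⟩
  rw [Real.dist_eq, Real.dist_eq] at hL
  rw [ha', hb', ← Real.log_div hRa0.ne' hRb0.ne']
  calc Real.log (Rf a / Rf b) ≤ Rf a / Rf b - 1 := Real.log_le_sub_one_of_pos (div_pos hRa0 hRb0)
    _ = (Rf a - Rf b) / Rf b := by rw [sub_div, div_self hRb0.ne']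
    _ ≤ |Rf a - Rf b| := by
        rw [div_le_iff₀ hRb0]
        calc Rf a - Rf b ≤ |Rf a - Rf b| := le_abs_self _
          _ = |Rf a - Rf b| * 1 := (mul_one _).symm
          _ ≤ |Rf a - Rf b| * Rf b := by gcongr
    _ ≤ L * |a - b| := hL

/-- **Strict monotonicity of the local EOS map on the dilute branch.** There is `η₀ > 0` such that for every
`σ > 0` and `0 < η < η'` with `η' σ³ < η₀`: `log η + βμ_ex(η σ³) < log η' + βμ_ex(η' σ³)`. Indeed
`log η' - log η ≥ 1 - η/η' = (η' - η)/η'` while `βμ_ex(η σ³) - βμ_ex(η' σ³) ≤ L σ³ (η' - η)`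
(`excessChemicalPotential_sub_le`), and `L σ³ η' < 1` once `η' σ³ < 1/(L + 1)`. -/
theorem eosMap_lt :
    ∃ η₀ : ℝ, 0 < η₀ ∧ ∀ σ : ℝ, 0 < σ → ∀ η η' : ℝ, 0 < η → η < η' → η' * σ ^ 3 < η₀ →
      Real.log η + excessChemicalPotential (η * σ ^ 3) <
        Real.log η' + excessChemicalPotential (η' * σ ^ 3) := by
  obtain ⟨η₂, hη₂, L, hL0, H⟩ := excessChemicalPotential_sub_le
  refine ⟨min η₂ (1 / (L + 1)), lt_min hη₂ (by positivity), fun σ hσ η η' hη hlt hsmall => ?_⟩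
  have hσ3 : 0 < σ ^ 3 := pow_pos hσ 3
  have hη' : 0 < η' := hη.trans hlt
  have hd : 0 < η' - η := sub_pos.2 hlt
  have hb : η' * σ ^ 3 ∈ Ioo 0 η₂ := ⟨mul_pos hη' hσ3, lt_of_lt_of_le hsmall (min_le_left _ _)⟩
  have ha : η * σ ^ 3 ∈ Ioo 0 η₂ :=
    ⟨mul_pos hη hσ3, (mul_lt_mul_of_pos_right hlt hσ3).trans hb.2⟩
  -- the excess part loses at most `L σ³ (η' - η)`
  have h1 := H _ ha _ hb
  have habs : |η * σ ^ 3 - η' * σ ^ 3| = (η' - η) * σ ^ 3 := by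
    rw [abs_sub_comm, abs_of_nonneg (by nlinarith)]
    ring
  rw [habs] at h1
  -- the ideal part gains at least `(η' - η)/η'`
  have h2 : (η' - η) / η' ≤ Real.log η' - Real.log η := by
    rw [← Real.log_div hη'.ne' hη.ne']
    have h := Real.one_sub_inv_le_log_of_pos (div_pos hη' hη)
    rw [inv_div] at h
    calc (η' - η) / η' = 1 - η / η' := by rw [sub_div, div_self hη'.ne']
      _ ≤ _ := h
  -- and `L σ³ η' < 1`
  have h3 : L * σ ^ 3 * η' < 1 := by
    have h : η' * σ ^ 3 < 1 / (L + 1) := lt_of_lt_of_le hsmall (min_le_right _ _)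
    rw [lt_div_iff₀ (by positivity)] at h
    nlinarith [mul_pos hη' hσ3]
  have h4 : L * ((η' - η) * σ ^ 3) < (η' - η) / η' := by
    rw [lt_div_iff₀ hη']
    nlinarith [mul_pos hd (sub_pos.2 h3)]
  linarith

/-! ### §2 (L1) Uniqueness of the EOS-related density -/

/-- **UNIQUENESS OF THE LOCAL-EQUILIBRIUM DENSITY (L1).** For a continuous positive activity profile `a₀` there is
`σ₀ > 0` such that for `0 < σ < σ₀` any two `EosRelated σ a₀` densities coincide. Proof: on the dilute branch
`n ≤ 2a₀/∫a₀ ≤ 2M` one has `n σ³ < η₀`, where the EOS map `g_σ(η) = log η + βμ_ex(η σ³)` is strictly increasing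
(`eosMap_lt`); if `n, n'` solve `g_σ(n x) = log a₀ x + c`, `g_σ(n' x) = log a₀ x + c'` with (wlog) `c ≤ c'`, then
`n ≤ n'` pointwise, so `c < c'` would give `n < n'` everywhere and `∫ n < ∫ n'` (continuous functions on `𝕋³`),
contradicting `∫ n = ∫ n' = 1`; hence `c = c'` and `n = n'` by injectivity of `g_σ`. -/
theorem eosRelated_unique {a₀ : T3 → ℝ} (ha : Continuous a₀) (ha0 : ∀ x, 0 < a₀ x) :
    ∃ σ₀ : ℝ, 0 < σ₀ ∧ ∀ σ : ℝ, 0 < σ → σ < σ₀ → ∀ n n' : T3 → ℝ,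
      EosRelated σ a₀ n → EosRelated σ a₀ n' → n = n' := by
  obtain ⟨η₀, hη₀, Hmono⟩ := eosMap_lt
  have hM := (profileOf a₀ ha ha0).M_pos
  refine ⟨min 1 (η₀ / (2 * (profileOf a₀ ha ha0).M)), lt_min one_pos (by positivity),
    fun σ hσ hσlt n n' hn hn' => ?_⟩
  have hσ1 : σ < 1 := lt_of_lt_of_le hσlt (min_le_left _ _)
  have hσM : σ < η₀ / (2 * (profileOf a₀ ha ha0).M) := lt_of_lt_of_le hσlt (min_le_right _ _)
  have hσ3 : σ ^ 3 ≤ σ := by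
    have e : σ ^ 3 = σ * (σ * σ) := by ring
    rw [e]; exact mul_le_of_le_one_right hσ.le (by nlinarith)
  -- on the dilute branch `m σ³ < η₀` for every EOS-related density `m`
  have hbranch : ∀ m : T3 → ℝ, EosRelated σ a₀ m → ∀ x, m x * σ ^ 3 < η₀ := by
    intro m hm x
    have hβM : a₀ x / (∫ y, a₀ y) ≤ (profileOf a₀ ha ha0).M := (profileOf a₀ ha ha0).le_M x
    have h1 : m x ≤ 2 * (profileOf a₀ ha ha0).M := (hm.2.2.1 x).trans (by linarith)
    calc m x * σ ^ 3 ≤ 2 * (profileOf a₀ ha ha0).M * σ ^ 3 :=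
          mul_le_mul_of_nonneg_right h1 (pow_pos hσ 3).le
      _ ≤ 2 * (profileOf a₀ ha ha0).M * σ := by gcongr
      _ < 2 * (profileOf a₀ ha ha0).M * (η₀ / (2 * (profileOf a₀ ha ha0).M)) := by gcongr
      _ = η₀ := mul_div_cancel₀ η₀ (by positivity)
  -- strict monotonicity read backwards
  have hle : ∀ m m' : T3 → ℝ, EosRelated σ a₀ m → EosRelated σ a₀ m' → ∀ x,
      Real.log (m x) + excessChemicalPotential (m x * σ ^ 3) ≤
        Real.log (m' x) + excessChemicalPotential (m' x * σ ^ 3) → m x ≤ m' x := by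
    intro m m' hm hm' x h
    by_contra hlt
    exact absurd h (not_le.2 (Hmono σ hσ (m' x) (m x) (hm'.2.1 x) (not_le.1 hlt) (hbranch m hm x)))
  -- the case of ordered constants
  have key : ∀ m m' : T3 → ℝ, EosRelated σ a₀ m → EosRelated σ a₀ m' → ∀ c c' : ℝ,
      (∀ x, Real.log (m x) + excessChemicalPotential (m x * σ ^ 3) = Real.log (a₀ x) + c) →
      (∀ x, Real.log (m' x) + excessChemicalPotential (m' x * σ ^ 3) = Real.log (a₀ x) + c') →
      c ≤ c' → m = m' := by
    intro m m' hm hm' c c' hc hc' hcc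
    have hmm : ∀ x, m x ≤ m' x := fun x => hle m m' hm hm' x (by rw [hc x, hc' x]; linarith)
    -- equal unit masses force `c = c'`
    have hceq : c = c' := by
      by_contra hne
      have hlt : c < c' := lt_of_le_of_ne hcc hne
      have hstrict : ∀ x, m x < m' x := by
        intro x
        refine lt_of_le_of_ne (hmm x) fun heq => ?_
        have h := hc' x
        rw [← heq, hc x] at h
        linarith
      have hpos : 0 < ∫ x, (m' x - m x) :=
        integral_pos_of_continuous_pos (hm'.1.sub hm.1) fun x => sub_pos.2 (hstrict x)
      rw [integral_sub (integrable_of_continuous_T3 hm'.1) (integrable_of_continuous_T3 hm.1), hm'.2.2.2.1,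
        hm.2.2.2.1] at hpos
      exact absurd hpos (by norm_num)
    subst hceq
    funext x
    exact le_antisymm (hmm x) (hle m' m hm' hm x (by rw [hc x, hc' x]))
  obtain ⟨c, hc⟩ := hn.2.2.2.2
  obtain ⟨c', hc'⟩ := hn'.2.2.2.2
  rcases le_total c c' with h | h
  · exact key n n' hn hn' c c' hc hc' h
  · exact (key n' n hn' hn c' c hc' hc h).symm

/-! ### §3 (L2) The cluster-series density is EOS-related -/

/-- **THE CLUSTER-SERIES DENSITY IS THE LOCAL-EQUILIBRIUM DENSITY (L2).** For a continuous positive activity profile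
`a₀` and all small `σ`, `rhoLim (profileOf a₀) σ` is `EosRelated σ a₀`: continuous and positive (`SmallDensity`, with
the positivity margin of `exists_smallDensity` at `min β`), on the dilute branch (`rhoLim_le_two_mul_β`), of unit mass
(`integral_rhoLim_eq_one`) and solving the EOS identity (`eosIdentityForRhoLim`). -/
theorem eosRelated_rhoLim {a₀ : T3 → ℝ} (ha : Continuous a₀) (ha0 : ∀ x, 0 < a₀ x) :
    ∃ σ₀ : ℝ, 0 < σ₀ ∧ ∀ σ : ℝ, 0 < σ → σ < σ₀ → EosRelated σ a₀ (rhoLim (profileOf a₀ ha ha0) σ) := by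
  set P := profileOf a₀ ha ha0 with hP
  obtain ⟨x₀, -, hx₀⟩ := isCompact_univ.exists_isMinOn univ_nonempty P.continuous.continuousOn
  have hβmin : ∀ y, P.β x₀ ≤ P.β y := fun y => (isMinOn_iff.mp hx₀) y (mem_univ y)
  obtain ⟨σa, hσa, Ha⟩ := exists_smallDensity P (P.pos x₀)
  obtain ⟨σb, hσb, Hb⟩ := rhoLim_le_two_mul_β ha ha0
  obtain ⟨σc, hσc, Hc⟩ := eosIdentityForRhoLim a₀ ha ha0
  refine ⟨min σa (min σb σc), lt_min hσa (lt_min hσb hσc), fun σ hσ hσlt => ?_⟩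
  have hσa' : σ < σa := lt_of_lt_of_le hσlt (min_le_left _ _)
  have hσb' : σ < σb := lt_of_lt_of_le hσlt ((min_le_right _ _).trans (min_le_left _ _))
  have hσc' : σ < σc := lt_of_lt_of_le hσlt ((min_le_right _ _).trans (min_le_right _ _))
  obtain ⟨hS, hposm⟩ := Ha σ hσ hσa'
  exact ⟨hS.continuous_rhoLim, fun x => hS.rhoLim_pos (hposm.trans_le (hβmin x)), Hb σ hσ hσb' hS,
    integral_rhoLim_eq_one hS, Hc σ hσ hσc'⟩

/-! ### §4 The crux as a flow-free EOS-data PDE statement -/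

/-- **`DenseExcursion` WITHOUT PARTICLES, FLOWS OR LIMITS IN PROBABILITY.** The crux holds iff for some `η > 0` and
continuous positive profiles `(a₀, u₀, θ₀)`, along a sequence `σ → 0`, the classical hard-sphere-Euler solution
(`p = ρθ Z(ρσ³)`) launched from an `EosRelated σ a₀` density `n` — by `eosRelated_unique` THE local-equilibrium
density of `a₀`, i.e. the continuous positive unit-mass solution of `log n + βμ_ex(n σ³) = log a₀ + const` on the
dilute branch — with velocity `u₀` and temperature `θ₀` reaches packing fraction `η`: `η ≤ ρ_t(x) σ³` for some
`t < T`, `x`. (⇒): below the thresholds of `admissible_iff_data` and `eosRelated_rhoLim` the admissible data are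
`(rhoLim (profileOf a₀) σ, u₀, θ₀)` and `rhoLim` is EOS-related; (⇐): below those and the uniqueness threshold,
`n = rhoLim (profileOf a₀) σ`, so the fields are admissible by `admissible_iff_data`; in both directions `T > 0`
(from `∃ t ∈ Ico 0 T`) makes the time-`0` slices continuous (`continuous_slices_zero`). -/
theorem denseExcursion_iff_eosData :
    DenseExcursion ↔
      ∃ η : ℝ, 0 < η ∧ ∃ (a₀ θ₀ : T3 → ℝ) (u₀ : T3 → V3), Continuous a₀ ∧ Continuous θ₀ ∧ Continuous u₀ ∧
        (∀ x, 0 < a₀ x) ∧ (∀ x, 0 < θ₀ x) ∧ ∀ σ₀ : ℝ, 0 < σ₀ → ∃ σ : ℝ, 0 < σ ∧ σ < σ₀ ∧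
          ∃ n : T3 → ℝ, EosRelated σ a₀ n ∧
            ∃ (T : ℝ) (ρ θ : ℝ → T3 → ℝ) (u : ℝ → T3 → V3), IsHardSphereEulerSolution σ T ρ u θ ∧
              ρ 0 = n ∧ u 0 = u₀ ∧ θ 0 = θ₀ ∧ ∃ t ∈ Set.Ico 0 T, ∃ x, η ≤ ρ t x * σ ^ 3 := by
  constructor
  · rintro ⟨η, hη, a₀, θ₀, u₀, ha, hθ, hu, ha0, hθ0, H⟩
    obtain ⟨σ₁, hσ₁, -, G⟩ := admissible_iff_data ha hθ hu ha0 hθ0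
    obtain ⟨σ₂, hσ₂, G₂⟩ := eosRelated_rhoLim ha ha0
    refine ⟨η, hη, a₀, θ₀, u₀, ha, hθ, hu, ha0, hθ0, fun σ₀ hσ₀ => ?_⟩
    obtain ⟨σ, hσ, hσlt, T, ρ, θ, u, hE, hA, t, ht, x, hx⟩ :=
      H (min σ₀ (min σ₁ σ₂)) (lt_min hσ₀ (lt_min hσ₁ hσ₂))
    have hσ₀' : σ < σ₀ := lt_of_lt_of_le hσlt (min_le_left _ _)
    have hσ₁' : σ < σ₁ := lt_of_lt_of_le hσlt ((min_le_right _ _).trans (min_le_left _ _))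
    have hσ₂' : σ < σ₂ := lt_of_lt_of_le hσlt ((min_le_right _ _).trans (min_le_right _ _))
    obtain ⟨hρc, huc, hθc⟩ := continuous_slices_zero hE (ht.1.trans_lt ht.2)
    obtain ⟨-, G'⟩ := G σ hσ hσ₁'
    obtain ⟨h1, h2, h3⟩ := (G' ρ θ u hρc huc hθc).1 hA
    exact ⟨σ, hσ, hσ₀', _, G₂ σ hσ hσ₂', T, ρ, θ, u, hE, h1, h2, h3, t, ht, x, hx⟩
  · rintro ⟨η, hη, a₀, θ₀, u₀, ha, hθ, hu, ha0, hθ0, H⟩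
    obtain ⟨σ₁, hσ₁, -, G⟩ := admissible_iff_data ha hθ hu ha0 hθ0
    obtain ⟨σ₂, hσ₂, G₂⟩ := eosRelated_rhoLim ha ha0
    obtain ⟨σ₃, hσ₃, G₃⟩ := eosRelated_unique ha ha0
    refine ⟨η, hη, a₀, θ₀, u₀, ha, hθ, hu, ha0, hθ0, fun σ₀ hσ₀ => ?_⟩
    obtain ⟨σ, hσ, hσlt, n, hn, T, ρ, θ, u, hE, h1, h2, h3, t, ht, x, hx⟩ :=
      H (min (min σ₀ σ₁) (min σ₂ σ₃)) (lt_min (lt_min hσ₀ hσ₁) (lt_min hσ₂ hσ₃))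
    have hσ₀' : σ < σ₀ := lt_of_lt_of_le hσlt ((min_le_left _ _).trans (min_le_left _ _))
    have hσ₁' : σ < σ₁ := lt_of_lt_of_le hσlt ((min_le_left _ _).trans (min_le_right _ _))
    have hσ₂' : σ < σ₂ := lt_of_lt_of_le hσlt ((min_le_right _ _).trans (min_le_left _ _))
    have hσ₃' : σ < σ₃ := lt_of_lt_of_le hσlt ((min_le_right _ _).trans (min_le_right _ _))
    obtain ⟨hρc, huc, hθc⟩ := continuous_slices_zero hE (ht.1.trans_lt ht.2)
    obtain ⟨-, G'⟩ := G σ hσ hσ₁'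
    have hn' : n = rhoLim (profileOf a₀ ha ha0) σ := G₃ σ hσ hσ₃' n _ hn (G₂ σ hσ hσ₂')
    exact ⟨σ, hσ, hσ₀', T, ρ, θ, u, hE, (G' ρ θ u hρc huc hθc).2 ⟨h1.trans hn', h2, h3⟩, t, ht, x, hx⟩

end Summit.AtomisticToContinuum.HydrodynamicLimit.Theorems.R2OneModeTwoConditions

end
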